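import Mathlib
import Summits.Ventures.PercRepro2.Defs
import Summits.Ventures.PercRepro2.Graph
import Summits.Ventures.PercRepro2.Induced
import Summits.Ventures.PercRepro2.VdBKahn
import Summits.Ventures.PercRepro2.ReimerVdBK
import Summits.Ventures.PercRepro2.ReimerVdBKRegions
import Summits.Ventures.PercRepro2.ReimerVdBKZClosed
import Summits.Ventures.PercRepro2.ReimerVdBKZReduction
import Summits.Ventures.PercRepro2.ReimerVdBKTwisted

/-!
# (R-1.2) when the doubly-avoided vertex is surrounded by side-pinned vertices
(blind cell PercRepro2, mine-c g45; `conjectures/MINE-C.md` §54.6 — a corollary of the Z-reduction)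

By `zReduction`, both sides of (R-1.2) for `(A, X ∪ {z}; B, Y ∪ {z})` (with `X ∩ Y = ∅` and `z` unmarked)
are the reduced two-world counts weighted by `∏_{e = {z,y}} ([y ∉ K₁′] + [y ∉ K₂′])`.  If every neighbour `y`
of `z` is PINNED TO A PRIVATE SIDE — `y ∈ A ∩ Y` (world-1-private on both sides) or `y ∈ B ∩ X`
(world-2-private on the left, world-1-private on the right) — every factor is `1` on both events, and the
reduced pair is a Harris pair: `U₁ ∩ bar U₂ ≤ U₁ ∩ U₂` for the upper sets `U₁ = {closeAt z ω ∈ Q_A} ∩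
{closeAt z (compl ω) ∈ R_Y}`, `U₂ = {closeAt z ω ∈ Q_B} ∩ {closeAt z (compl ω) ∈ R_X}`
(`count_inter_bar_le_count_inter`).  THEOREM `rvdBK_of_surrounded`: (R-1.2) holds for such instances.
(The theorem is genuinely beyond `rvdBK_of_disjoint`: `Z = {z} ≠ ∅`, and `z` may have any degree,
parallel edges and loops.)
-/

namespace Summit.Ventures.PercRepro2

namespace ReimerVdBK

open Classical

variable {V : Type*} {E : Type*} [Fintype E] [DecidableEq E] [Fintype V] [DecidableEq V]

variable (ends : E → Sym2 V) (s : V)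

/-! ## Monotonicity of the reduced worlds -/

omit [Fintype E] [DecidableEq E] [Fintype V] in
/-- `closeAt z` is monotone. -/
lemma closeAt_mono (z : V) {ω ω' : Config E} (h : ω ≤ ω') : closeAt ends z ω ≤ closeAt ends z ω' := by
  intro e
  by_cases he : z ∈ ends e
  · rw [closeAt_apply_of_mem ends he, closeAt_apply_of_mem ends he]
  · rw [closeAt_apply_of_notMem ends he, closeAt_apply_of_notMem ends he]; exact h e

omit [Fintype E] [DecidableEq E] [Fintype V] in
/-- `{ω : closeAt z ω ∈ Q_A}` is an upper set. -/
lemma isUpperSet_del_connAll (z : V) (A : Finset V) :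
    IsUpperSet {ω : Config E | ∀ a ∈ A, Conn ends (closeAt ends z ω) s a} := by
  intro ω ω' h hω a ha
  exact conn_mono (closeAt_mono ends z h) (hω a ha)

omit [Fintype E] [DecidableEq E] [Fintype V] in
/-- `{ω : closeAt z (compl ω) ∈ R_Y}` is an upper set. -/
lemma isUpperSet_del_avoidAll_compl (z : V) (Y : Finset V) :
    IsUpperSet {ω : Config E | ∀ y ∈ Y, ¬ Conn ends (closeAt ends z (compl ω)) s y} := by
  intro ω ω' h hω y hy hc
  exact hω y hy (conn_mono (closeAt_mono ends z (compl_le_compl h)) hc)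

omit [Fintype E] [DecidableEq E] [Fintype V] in
/-- The reduced two-world event is `U₁ ∩ bar U₂` for the two upper sets of the docstring. -/
lemma delTwoWorld_eq (z : V) (A X B Y : Finset V) :
    delTwoWorld ends s z A X B Y =
      ({ω : Config E | ∀ a ∈ A, Conn ends (closeAt ends z ω) s a} ∩
        {ω : Config E | ∀ y ∈ Y, ¬ Conn ends (closeAt ends z (compl ω)) s y}) ∩
      bar ({ω : Config E | ∀ b ∈ B, Conn ends (closeAt ends z ω) s b} ∩
        {ω : Config E | ∀ x ∈ X, ¬ Conn ends (closeAt ends z (compl ω)) s x}) := by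
  ext ω
  simp only [delTwoWorld, Set.mem_inter_iff, Set.mem_setOf_eq, mem_bar, compl_compl]
  tauto

omit [Fintype E] [DecidableEq E] [Fintype V] in
/-- The reduced right-side event for `X ∩ Y = ∅` is `U₁ ∩ U₂`. -/
lemma delTwoWorld_right_eq (z : V) (A X B Y : Finset V) :
    delTwoWorld ends s z (A ∪ B) ∅ ∅ (X ∪ Y) =
      ({ω : Config E | ∀ a ∈ A, Conn ends (closeAt ends z ω) s a} ∩
        {ω : Config E | ∀ y ∈ Y, ¬ Conn ends (closeAt ends z (compl ω)) s y}) ∩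
      ({ω : Config E | ∀ b ∈ B, Conn ends (closeAt ends z ω) s b} ∩
        {ω : Config E | ∀ x ∈ X, ¬ Conn ends (closeAt ends z (compl ω)) s x}) := by
  ext ω
  simp only [delTwoWorld, Set.mem_inter_iff, Set.mem_setOf_eq, Finset.mem_union,
    Finset.notMem_empty, false_imp_iff, imp_true_iff, true_and]
  constructor
  · rintro ⟨hab, hxy⟩
    exact ⟨⟨fun a ha => hab a (Or.inl ha), fun y hy => hxy y (Or.inr hy)⟩,
      fun b hb => hab b (Or.inr hb), fun x hx => hxy x (Or.inl hx)⟩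
  · rintro ⟨⟨ha, hy⟩, hb, hx⟩
    exact ⟨fun v hv => hv.elim (ha v) (hb v), fun v hv => hv.elim (hx v) (hy v)⟩

omit [Fintype V] in
/-- **Harris for the reduced pair**: for `X ∩ Y = ∅`,
`#delTwoWorld(A, X; B, Y) ≤ #delTwoWorld(A ∪ B, ∅; ∅, X ∪ Y)`. -/
theorem count_delTwoWorld_le (z : V) (A X B Y : Finset V) :
    count (delTwoWorld ends s z A X B Y) ≤ count (delTwoWorld ends s z (A ∪ B) ∅ ∅ (X ∪ Y)) := by
  rw [delTwoWorld_eq, delTwoWorld_right_eq]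
  exact count_inter_bar_le_count_inter
    ((isUpperSet_del_connAll ends s z A).inter (isUpperSet_del_avoidAll_compl ends s z Y))
    ((isUpperSet_del_connAll ends s z B).inter (isUpperSet_del_avoidAll_compl ends s z X))

/-! ## The surrounded case -/

/-- «`z` is surrounded»: every edge at `z` leads to a vertex `y ≠ z` of `(A ∩ Y) ∪ (B ∩ X)` (no loops at `z`). -/
def Surrounded (z : V) (A X B Y : Finset V) : Prop :=
  ∀ e y, ends e = s(z, y) → y ≠ z ∧ ((y ∈ A ∧ y ∈ Y) ∨ (y ∈ B ∧ y ∈ X))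

omit [Fintype E] [DecidableEq E] [Fintype V] in
/-- The right-side instance of a surrounded `z` is surrounded. -/
lemma Surrounded.right {z : V} {A X B Y : Finset V} (hs : Surrounded ends z A X B Y) :
    Surrounded ends z (A ∪ B) ∅ ∅ (X ∪ Y) := by
  intro e y hy
  obtain ⟨hyz, h⟩ := hs e y hy
  refine ⟨hyz, Or.inl ?_⟩
  rcases h with ⟨hA, hY⟩ | ⟨hB, hX⟩
  · exact ⟨Finset.mem_union_left _ hA, Finset.mem_union_right _ hY⟩
  · exact ⟨Finset.mem_union_right _ hB, Finset.mem_union_left _ hX⟩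

omit [DecidableEq E] in
/-- On the reduced event of a surrounded `z`, every factor sum at `z` is `1`. -/
lemma awayFactor_sum_eq_one {z : V} {A X B Y : Finset V} (hs : Surrounded ends z A X B Y)
    {ω : Config E} (hω : ω ∈ delTwoWorld ends s z A X B Y) {e : E} (he : e ∈ edgesAt ends z) :
    awayFactor ends s z e ω true + awayFactor ends s z e ω false = 1 := by
  have hze : z ∈ ends e := by simpa [edgesAt] using he
  obtain ⟨y, hy⟩ := Sym2.mem_iff_exists.1 hze
  obtain ⟨hyz, hpin⟩ := hs e y hy
  rw [awayFactor_sum ends s hy hyz ω]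
  obtain ⟨ha, hx, hb, hyy⟩ := hω
  rcases hpin with ⟨hyA, hyY⟩ | ⟨hyB, hyX⟩
  · rw [if_pos (ha y hyA), if_neg (hyy y hyY)]; norm_num
  · rw [if_neg (hx y hyX), if_pos (hb y hyB)]; norm_num

/-- The weighted reduced count of a surrounded `z` is the plain reduced count. -/
lemma weighted_del_eq_count {z : V} {A X B Y : Finset V} (hs : Surrounded ends z A X B Y) :
    ∑ ω : Config E, (if ω ∈ delTwoWorld ends s z A X B Y then 1 else 0) *
        ∏ e ∈ edgesAt ends z, (awayFactor ends s z e ω true + awayFactor ends s z e ω false) =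
      (count (delTwoWorld ends s z A X B Y) : ℚ) := by
  unfold count
  push_cast
  refine Finset.sum_congr rfl fun ω _ => ?_
  by_cases hω : ω ∈ delTwoWorld ends s z A X B Y
  · rw [if_pos hω, Finset.prod_eq_one fun e he => awayFactor_sum_eq_one ends s hs hω he]; ring
  · rw [if_neg hω]; ring

/-- **(R-1.2) for a surrounded doubly-avoided vertex**: if `X ∩ Y = ∅`, `z ≠ s` is unmarked, and every
edge at `z` leads to a vertex of `(A ∩ Y) ∪ (B ∩ X)`, then `Φ(A, X ∪ {z}; B, Y ∪ {z}) ≤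
Φ(A ∪ B, {z}; ∅, X ∪ Y ∪ {z})`. -/
theorem rvdBK_of_surrounded {z : V} {A X B Y : Finset V} (hz : z ∉ A ∪ X ∪ B ∪ Y) (hsz : s ≠ z)
    (hXY : X ∩ Y = ∅) (hs : Surrounded ends z A X B Y) :
    RvdBK ends s A (insert z X) B (insert z Y) := by
  have hz' : z ∉ (A ∪ B) ∪ ∅ ∪ ∅ ∪ (X ∪ Y) := by
    intro h; apply hz
    simp only [Finset.mem_union, Finset.notMem_empty, or_false] at h ⊢
    tauto
  have hX : insert z X ∩ insert z Y = insert z (∅ : Finset V) := by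
    rw [← hXY]; ext v; simp only [Finset.mem_inter, Finset.mem_insert]; tauto
  have hY : insert z X ∪ insert z Y = insert z (X ∪ Y) := by
    ext v; simp only [Finset.mem_union, Finset.mem_insert]; tauto
  unfold RvdBK
  rw [hX, hY, ← Nat.cast_le (α := ℚ)]
  have h1 := zReduction ends s hz hsz
  have h2 := zReduction ends s hz' hsz
  rw [weighted_del_eq_count ends s hs] at h1
  rw [weighted_del_eq_count ends s (Surrounded.right ends hs)] at h2
  have hpos : (0 : ℚ) < (2 : ℚ) ^ (edgesAt ends z).card := by positivity
  have hle : (count (delTwoWorld ends s z A X B Y) : ℚ) ≤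
      count (delTwoWorld ends s z (A ∪ B) ∅ ∅ (X ∪ Y)) := by
    exact_mod_cast count_delTwoWorld_le ends s z A X B Y
  rw [← h1, ← h2] at hle
  exact le_of_mul_le_mul_left hle hpos

/-! ## The general case: every neighbour of `z` is connection-marked -/

/-- «The neighbours of `z` are marked»: every edge at `z` leads to a vertex `y ≠ z` of `A ∪ B`. -/
def NbrsMarked (z : V) (A B : Finset V) : Prop :=
  ∀ e y, ends e = s(z, y) → y ≠ z ∧ (y ∈ A ∨ y ∈ B)

/-- The event «every `A`-neighbour of `z` is outside the reduced world 2». -/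
def nbrEventA (z : V) (A : Finset V) : Set (Config E) :=
  {ω | ∀ e y, ends e = s(z, y) → y ∈ A → ¬ Conn ends (closeAt ends z (compl ω)) s y}

omit [Fintype E] [DecidableEq E] [Fintype V] in
/-- `nbrEventA` is an upper set. -/
lemma isUpperSet_nbrEventA (z : V) (A : Finset V) : IsUpperSet (nbrEventA ends s z A) := by
  intro ω ω' h hω e y hy hyA hc
  exact hω e y hy hyA (conn_mono (closeAt_mono ends z (compl_le_compl h)) hc)

omit [Fintype E] [DecidableEq E] [Fintype V] in
/-- The bar of `nbrEventA z B` is «every `B`-neighbour of `z` is outside the reduced world 1». -/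
lemma mem_bar_nbrEventA (z : V) (B : Finset V) (ω : Config E) :
    ω ∈ bar (nbrEventA ends s z B) ↔
      ∀ e y, ends e = s(z, y) → y ∈ B → ¬ Conn ends (closeAt ends z ω) s y := by
  simp only [mem_bar, nbrEventA, Set.mem_setOf_eq, compl_compl]

omit [DecidableEq E] in
/-- On the reduced LEFT event with marked neighbours, the product of the factor sums at `z` is the
indicator of `nbrEventA z A ∩ bar (nbrEventA z B)`. -/
lemma prod_awayFactor_left {z : V} {A X B Y : Finset V} (hn : NbrsMarked ends z A B) {ω : Config E}
    (hω : ω ∈ delTwoWorld ends s z A X B Y) :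
    ∏ e ∈ edgesAt ends z, (awayFactor ends s z e ω true + awayFactor ends s z e ω false) =
      if ω ∈ nbrEventA ends s z A ∩ bar (nbrEventA ends s z B) then 1 else 0 := by
  obtain ⟨ha, hx, hb, hyy⟩ := hω
  -- each factor sum is the indicator of the edge's condition
  have hfac : ∀ e ∈ edgesAt ends z, ∀ y, ends e = s(z, y) →
      awayFactor ends s z e ω true + awayFactor ends s z e ω false =
        if (y ∈ A → ¬ Conn ends (closeAt ends z (compl ω)) s y) ∧
            (y ∈ B → ¬ Conn ends (closeAt ends z ω) s y) then 1 else 0 := by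
    intro e _ y hy
    obtain ⟨hyz, hyAB⟩ := hn e y hy
    rw [awayFactor_sum ends s hy hyz ω]
    rcases hyAB with hyA | hyB
    · have h1 : Conn ends (closeAt ends z ω) s y := ha y hyA
      by_cases h2 : Conn ends (closeAt ends z (compl ω)) s y
      · simp [h1, h2, hyA]
      · by_cases hyB : y ∈ B
        · have := hb y hyB; exact absurd this h2
        · simp [h1, h2, hyA, hyB]
    · have h2 : Conn ends (closeAt ends z (compl ω)) s y := hb y hyB
      by_cases h1 : Conn ends (closeAt ends z ω) s y
      · simp [h1, h2, hyB]
      · by_cases hyA : y ∈ A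
        · have := ha y hyA; exact absurd this h1
        · simp [h1, h2, hyA, hyB]
  by_cases hmem : ω ∈ nbrEventA ends s z A ∩ bar (nbrEventA ends s z B)
  · rw [if_pos hmem]
    obtain ⟨hA, hB⟩ := hmem
    rw [mem_bar_nbrEventA] at hB
    refine Finset.prod_eq_one fun e he => ?_
    have hze : z ∈ ends e := by simpa [edgesAt] using he
    obtain ⟨y, hy⟩ := Sym2.mem_iff_exists.1 hze
    rw [hfac e he y hy, if_pos ⟨fun hyA => hA e y hy hyA, fun hyB => hB e y hy hyB⟩]
  · rw [if_neg hmem]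
    -- some neighbour violates its condition: that factor is `0`
    have : ∃ e ∈ edgesAt ends z, ∃ y, ends e = s(z, y) ∧
        ¬ ((y ∈ A → ¬ Conn ends (closeAt ends z (compl ω)) s y) ∧
            (y ∈ B → ¬ Conn ends (closeAt ends z ω) s y)) := by
      by_contra hcon
      push Not at hcon
      apply hmem
      refine ⟨fun e y hy hyA => ?_, ?_⟩
      · have he : e ∈ edgesAt ends z := by
          simp only [edgesAt, Finset.mem_filter, Finset.mem_univ, true_and]
          rw [hy]; exact Sym2.mem_mk_left z y
        exact (hcon e he y hy).1 hyA
      · rw [mem_bar_nbrEventA]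
        intro e y hy hyB
        have he : e ∈ edgesAt ends z := by
          simp only [edgesAt, Finset.mem_filter, Finset.mem_univ, true_and]
          rw [hy]; exact Sym2.mem_mk_left z y
        exact (hcon e he y hy).2 hyB
    obtain ⟨e, he, y, hy, hbad⟩ := this
    refine Finset.prod_eq_zero he ?_
    rw [hfac e he y hy, if_neg hbad]

omit [DecidableEq E] in
/-- On the reduced RIGHT event with marked neighbours, the product of the factor sums at `z` is the
indicator of `nbrEventA z A ∩ nbrEventA z B`. -/
lemma prod_awayFactor_right {z : V} {A X B Y : Finset V} (hn : NbrsMarked ends z A B) {ω : Config E}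
    (hω : ω ∈ delTwoWorld ends s z (A ∪ B) ∅ ∅ (X ∪ Y)) :
    ∏ e ∈ edgesAt ends z, (awayFactor ends s z e ω true + awayFactor ends s z e ω false) =
      if ω ∈ nbrEventA ends s z A ∩ nbrEventA ends s z B then 1 else 0 := by
  obtain ⟨hab, -, -, -⟩ := hω
  have hfac : ∀ e ∈ edgesAt ends z, ∀ y, ends e = s(z, y) →
      awayFactor ends s z e ω true + awayFactor ends s z e ω false =
        if ¬ Conn ends (closeAt ends z (compl ω)) s y then 1 else 0 := by
    intro e _ y hy
    obtain ⟨hyz, hyAB⟩ := hn e y hy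
    rw [awayFactor_sum ends s hy hyz ω]
    have h1 : Conn ends (closeAt ends z ω) s y :=
      hab y (by rcases hyAB with h | h <;> simp [h])
    by_cases h2 : Conn ends (closeAt ends z (compl ω)) s y <;> simp [h1, h2]
  by_cases hmem : ω ∈ nbrEventA ends s z A ∩ nbrEventA ends s z B
  · rw [if_pos hmem]
    obtain ⟨hA, hB⟩ := hmem
    refine Finset.prod_eq_one fun e he => ?_
    have hze : z ∈ ends e := by simpa [edgesAt] using he
    obtain ⟨y, hy⟩ := Sym2.mem_iff_exists.1 hze
    obtain ⟨_, hyAB⟩ := hn e y hy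
    rw [hfac e he y hy, if_pos]
    rcases hyAB with hyA | hyB
    · exact hA e y hy hyA
    · exact hB e y hy hyB
  · rw [if_neg hmem]
    have : ∃ e ∈ edgesAt ends z, ∃ y, ends e = s(z, y) ∧ Conn ends (closeAt ends z (compl ω)) s y := by
      by_contra hcon
      push Not at hcon
      apply hmem
      have key : ∀ e y, ends e = s(z, y) → ¬ Conn ends (closeAt ends z (compl ω)) s y := by
        intro e y hy
        have he : e ∈ edgesAt ends z := by
          simp only [edgesAt, Finset.mem_filter, Finset.mem_univ, true_and]
          rw [hy]; exact Sym2.mem_mk_left z y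
        exact hcon e he y hy
      exact ⟨fun e y hy _ => key e y hy, fun e y hy _ => key e y hy⟩
    obtain ⟨e, he, y, hy, hbad⟩ := this
    refine Finset.prod_eq_zero he ?_
    rw [hfac e he y hy, if_neg (not_not.2 hbad)]

omit [Fintype E] [DecidableEq E] [Fintype V] in
/-- The left reduced event with its neighbour conditions is `U₁′ ∩ bar U₂′`. -/
lemma delTwoWorld_nbr_left_eq (z : V) (A X B Y : Finset V) :
    delTwoWorld ends s z A X B Y ∩ (nbrEventA ends s z A ∩ bar (nbrEventA ends s z B)) =
      (({ω : Config E | ∀ a ∈ A, Conn ends (closeAt ends z ω) s a} ∩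
        {ω : Config E | ∀ y ∈ Y, ¬ Conn ends (closeAt ends z (compl ω)) s y}) ∩ nbrEventA ends s z A) ∩
      bar (({ω : Config E | ∀ b ∈ B, Conn ends (closeAt ends z ω) s b} ∩
        {ω : Config E | ∀ x ∈ X, ¬ Conn ends (closeAt ends z (compl ω)) s x}) ∩ nbrEventA ends s z B) := by
  rw [delTwoWorld_eq, bar_inter, bar_inter, bar_inter]
  ext ω; simp only [Set.mem_inter_iff]; tauto

omit [Fintype E] [DecidableEq E] [Fintype V] in
/-- The right reduced event with its neighbour conditions is `U₁′ ∩ U₂′`. -/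
lemma delTwoWorld_nbr_right_eq (z : V) (A X B Y : Finset V) :
    delTwoWorld ends s z (A ∪ B) ∅ ∅ (X ∪ Y) ∩ (nbrEventA ends s z A ∩ nbrEventA ends s z B) =
      (({ω : Config E | ∀ a ∈ A, Conn ends (closeAt ends z ω) s a} ∩
        {ω : Config E | ∀ y ∈ Y, ¬ Conn ends (closeAt ends z (compl ω)) s y}) ∩ nbrEventA ends s z A) ∩
      (({ω : Config E | ∀ b ∈ B, Conn ends (closeAt ends z ω) s b} ∩
        {ω : Config E | ∀ x ∈ X, ¬ Conn ends (closeAt ends z (compl ω)) s x}) ∩ nbrEventA ends s z B) := by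
  rw [delTwoWorld_right_eq]
  ext ω; simp only [Set.mem_inter_iff]; tauto

/-- **(R-1.2) for a doubly-avoided vertex whose neighbours are all connection-marked**: if `X ∩ Y = ∅`,
`z ≠ s` is unmarked, and every edge at `z` leads to a vertex of `A ∪ B`, then
`Φ(A, X ∪ {z}; B, Y ∪ {z}) ≤ Φ(A ∪ B, {z}; ∅, X ∪ Y ∪ {z})`. -/
theorem rvdBK_of_nbrsMarked {z : V} {A X B Y : Finset V} (hz : z ∉ A ∪ X ∪ B ∪ Y) (hsz : s ≠ z)
    (hXY : X ∩ Y = ∅) (hn : NbrsMarked ends z A B) :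
    RvdBK ends s A (insert z X) B (insert z Y) := by
  have hz' : z ∉ (A ∪ B) ∪ ∅ ∪ ∅ ∪ (X ∪ Y) := by
    intro h; apply hz
    simp only [Finset.mem_union, Finset.notMem_empty, or_false] at h ⊢
    tauto
  have hX : insert z X ∩ insert z Y = insert z (∅ : Finset V) := by
    rw [← hXY]; ext v; simp only [Finset.mem_inter, Finset.mem_insert]; tauto
  have hY : insert z X ∪ insert z Y = insert z (X ∪ Y) := by
    ext v; simp only [Finset.mem_union, Finset.mem_insert]; tauto
  unfold RvdBK
  rw [hX, hY, ← Nat.cast_le (α := ℚ)]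
  have h1 := zReduction ends s hz hsz
  have h2 := zReduction ends s hz' hsz
  -- the weighted sums are the counts of the neighbour-conditioned reduced events
  have e1 : ∑ ω : Config E, (if ω ∈ delTwoWorld ends s z A X B Y then 1 else 0) *
      ∏ e ∈ edgesAt ends z, (awayFactor ends s z e ω true + awayFactor ends s z e ω false) =
      (count (delTwoWorld ends s z A X B Y ∩ (nbrEventA ends s z A ∩ bar (nbrEventA ends s z B))) : ℚ) := by
    unfold count; push_cast
    refine Finset.sum_congr rfl fun ω _ => ?_
    by_cases hω : ω ∈ delTwoWorld ends s z A X B Y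
    · rw [if_pos hω, prod_awayFactor_left ends s hn hω]
      by_cases hm : ω ∈ nbrEventA ends s z A ∩ bar (nbrEventA ends s z B)
      · rw [if_pos hm, if_pos ⟨hω, hm⟩]; ring
      · rw [if_neg hm, if_neg (fun h => hm h.2)]; ring
    · rw [if_neg hω, if_neg (fun h => hω h.1)]; ring
  have e2 : ∑ ω : Config E, (if ω ∈ delTwoWorld ends s z (A ∪ B) ∅ ∅ (X ∪ Y) then 1 else 0) *
      ∏ e ∈ edgesAt ends z, (awayFactor ends s z e ω true + awayFactor ends s z e ω false) =
      (count (delTwoWorld ends s z (A ∪ B) ∅ ∅ (X ∪ Y) ∩ (nbrEventA ends s z A ∩ nbrEventA ends s z B)) : ℚ) := by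
    unfold count; push_cast
    refine Finset.sum_congr rfl fun ω _ => ?_
    by_cases hω : ω ∈ delTwoWorld ends s z (A ∪ B) ∅ ∅ (X ∪ Y)
    · rw [if_pos hω, prod_awayFactor_right ends s hn hω]
      by_cases hm : ω ∈ nbrEventA ends s z A ∩ nbrEventA ends s z B
      · rw [if_pos hm, if_pos ⟨hω, hm⟩]; ring
      · rw [if_neg hm, if_neg (fun h => hm h.2)]; ring
    · rw [if_neg hω, if_neg (fun h => hω h.1)]; ring
  rw [e1] at h1
  rw [e2] at h2
  have hpos : (0 : ℚ) < (2 : ℚ) ^ (edgesAt ends z).card := by positivity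
  have hle : (count (delTwoWorld ends s z A X B Y ∩ (nbrEventA ends s z A ∩ bar (nbrEventA ends s z B))) : ℚ) ≤
      count (delTwoWorld ends s z (A ∪ B) ∅ ∅ (X ∪ Y) ∩ (nbrEventA ends s z A ∩ nbrEventA ends s z B)) := by
    rw [delTwoWorld_nbr_left_eq, delTwoWorld_nbr_right_eq]
    exact_mod_cast count_inter_bar_le_count_inter
      (((isUpperSet_del_connAll ends s z A).inter (isUpperSet_del_avoidAll_compl ends s z Y)).inter
        (isUpperSet_nbrEventA ends s z A))
      (((isUpperSet_del_connAll ends s z B).inter (isUpperSet_del_avoidAll_compl ends s z X)).inter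
        (isUpperSet_nbrEventA ends s z B))
  rw [← h1, ← h2] at hle
  exact le_of_mul_le_mul_left hle hpos

end ReimerVdBK

end Summit.Ventures.PercRepro2
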